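import Literature.Analysis.UnboundedOperators.LinearizedBoltzmannPointwiseInverse
import Literature.Analysis.UnboundedOperators.LinearizedBoltzmannKernelActionContinuity
import HarnessLib

/-!
# The continuous Chapman–Enskog inverse of the linearised hard-sphere operator in `ℝ³`

Assembly of `LinearizedBoltzmannPointwiseInverse` (the everywhere-defined `L²(M dv)`-solution of
`L ψ₀ = g` with Gaussian growth) and `LinearizedBoltzmannKernelActionContinuity` (continuity of the
kernel action under Gaussian growth): for every bounded continuous `g` on `ℝ³` which is
`M`-orthogonal to the collision invariants `span {1, v, |v|²}` there is a **continuous** `ψ₀` with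
`L ψ₀ = g` everywhere, `ψ₀ ∈ L²(M dv)`, `λ ‖ψ₀‖ ≤ ‖g‖`, `ψ₀ ⊥_M` the invariants and
`|ψ₀(v)| ≤ C₀ ‖g‖_∞ e^{|v|²/4}`, with absolute constants `λ, C₀`
(`exists_continuous_inverse_hardSphereLinearizedOp`; CIP 1994 §7.2, Fredholm alternative for the
linearised Boltzmann operator, with the continuous representative `ψ₀ = ν⁻¹ (K ψ₀ - g)`).
What is NOT here: the sup-norm bound `‖ψ₀‖_∞ ≤ C ‖g‖_∞` (Grad's weighted `L^∞` theory at the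
borderline Maxwellian weight `M^{1/2}`, not covered by the polynomial/sub-Gaussian weights of
Grad 1963 / Caflisch 1980 / Guo 2010). No new definitions are introduced.
-/

open MeasureTheory Metric Real Set Filter Topology ProbabilityTheory Module
open scoped InnerProductSpace ENNReal

namespace Literature.Analysis.UnboundedOperators

noncomputable section

open Literature.MathematicalPhysics.KineticTheory (collide sphereMeasure hardSphereKernel)
open Literature.Analysis.FluidPDE

/-- **The continuous Chapman–Enskog inverse of the linearised hard-sphere operator in `ℝ³`.** There are
absolute constants `λ > 0` (the spectral gap) and `C₀ > 0` such that every bounded continuous `g`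
on `ℝ³` which is `M`-orthogonal to the collision invariants `span {1, v, |v|²}` has a **continuous**
pre-image `ψ₀` under the linearised hard-sphere operator, `L ψ₀ (v) = g(v)` at every `v`, with
`ψ₀ ∈ L²(M dv)`, `λ ‖ψ₀‖_{L²(M)} ≤ ‖g‖_{L²(M)}`, `ψ₀ ⊥_M` the collision invariants, and the Gaussian
growth bound `|ψ₀(v)| ≤ C₀ ‖g‖_∞ e^{|v|²/4}` (CIP 1994 §7.2: Fredholm alternative for `L h = g`; the
representative is `ψ₀ = ν⁻¹ (K ψ₀ - g)` with Grad's kernel part `K`). The sup-norm bound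
`‖ψ₀‖_∞ ≤ C ‖g‖_∞` of Grad's weighted `L^∞` theory at the borderline Maxwellian weight is NOT
asserted here. [cite: CIPDiluteGases1994, §7.2 Thm 7.2.1 and Thm 7.2.5] -/
theorem exists_continuous_inverse_hardSphereLinearizedOp :
    ∃ lam C₀ : ℝ, 0 < lam ∧ 0 < C₀ ∧ ∀ (g : EuclideanSpace ℝ (Fin 3) → ℝ) (b : ℝ), Continuous g →
      (∀ v, |g v| ≤ b) →
      (∀ φ ∈ collisionInvariants (EuclideanSpace ℝ (Fin 3)), maxwellianInner g φ = 0) →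
      ∃ ψ₀ : EuclideanSpace ℝ (Fin 3) → ℝ, Continuous ψ₀ ∧
        (∀ v, |ψ₀ v| ≤ C₀ * b * Real.exp (‖v‖ ^ 2 / 4)) ∧
        MemLp ψ₀ 2 (stdGaussian (EuclideanSpace ℝ (Fin 3))) ∧
        lam * (eLpNorm ψ₀ 2 (stdGaussian (EuclideanSpace ℝ (Fin 3)))).toReal ≤
          (eLpNorm g 2 (stdGaussian (EuclideanSpace ℝ (Fin 3)))).toReal ∧
        (∀ φ ∈ collisionInvariants (EuclideanSpace ℝ (Fin 3)), maxwellianInner ψ₀ φ = 0) ∧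
        ∀ v, hardSphereLinearizedOp ψ₀ v = g v := by
  obtain ⟨lam, C₀, hlam, hC₀, h⟩ := exists_pointwise_inverse_hardSphereLinearizedOp
  refine ⟨lam, C₀, hlam, hC₀, fun g b hg hb horth => ?_⟩
  obtain ⟨ψ₀, hψm, hgrowth, hmem, hnorm, horth', hfix, hL⟩ := h g b hg.measurable hb horth
  exact ⟨ψ₀, continuous_of_gaussGrowth_of_fixedPoint hψm hgrowth hg hfix, hgrowth, hmem, hnorm, horth', hL⟩

end

end Literature.Analysis.UnboundedOperators
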